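import Literature.AlgebraicGeometry.Morphisms.ZariskiConnectednessProjective
import HarnessLib

/-!
# Zariski's connectedness theorem and Stein factorisation for projective morphisms over a Noetherian ring

Assembly of `Literature/AlgebraicGeometry/Morphisms/SteinFactorizationLocalCriterion.lean` (the
reduction of geometric connectedness of fibres to the local connectedness core, for a class of rings and
a base-change-stable class of morphisms) with
`Literature/AlgebraicGeometry/Morphisms/ZariskiConnectednessProjective.lean` (the core for Noetherian
local rings and projective morphisms):

* `geometricallyConnected_of_projective` — **Zariski's connectedness theorem** (Hartshorne III Cor. 11.3;
  EGA III₁ 4.3.2, 4.3.4): for `B` Noetherian and `g : Y → Spec B` admitting a closed `B`-immersion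
  `Y ↪ 𝐏^r_B`, with `B ≅ Γ(Y, 𝒪_Y)`, the morphism `g` is geometrically connected (all fibres are
  geometrically connected);
* `steinFactorization_geometricallyConnected_projective` — **The Stacks Project, Tag 03H2 (1) for
  projective morphisms over a Noetherian affine base**: for `f : X → Spec A`, `A` Noetherian, with a closed
  `A`-immersion `X ↪ 𝐏^r_A`, the morphism `f' : X → S'` to the normalisation of `Spec A` in `X` is
  geometrically connected — the statement of the named fact
  `Literature.AlgebraicGeometry.Morphisms.steinFactorization_geometricallyConnected` for such `f`
  (`S'` is affine with `Γ(S') ≅ Γ(X, 𝒪_X)` finite over `A`, and `X` is projective over it).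

Everything is proved; theorems only; no named facts are introduced.

## References

* R. Hartshorne, *Algebraic Geometry*, GTM 52 (1977), III Cor. 11.3.
* A. Grothendieck, EGA III₁, Corollaires 4.3.2, 4.3.4.
* The Stacks Project, Tag 03H2 (More on Morphisms, Theorem 37.53.5 (1)), Tag 03H0 (Theorem 37.53.4).
-/

noncomputable section

open CategoryTheory AlgebraicGeometry Limits TopologicalSpace Opposite

universe u

namespace Literature.AlgebraicGeometry.Morphisms

open IsLocalRing

/-- **Zariski's connectedness theorem, projective over a Noetherian ring** (Hartshorne, *Algebraic
Geometry*, III Cor. 11.3 with EGA III₁ 4.3.4: geometric connectedness). Let `B` be a Noetherian ring and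
`g : Y → Spec B` a morphism admitting a closed `B`-immersion `Y ↪ 𝐏^r_B`, with `B → Γ(Y, 𝒪_Y)` an
isomorphism (`f_* 𝒪_X = 𝒪_Y` over the affine base). Then `g` is geometrically connected: all fibres
are geometrically connected. Proof: the reduction `SteinFibre.geometricallyConnected_of_localConn`
(finite free local base changes, localisation, closed points and Tag 04KV;
`Literature/AlgebraicGeometry/Morphisms/SteinFactorizationLocalCriterion.lean`) for the classes
`𝒩 = {Noetherian rings}` and `𝒞 = {morphisms with a closed immersion into 𝐏^r over the base}` (stable:
`ZariskiProj.exists_isClosedImmersion_pullback`), whose local core is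
`ZariskiProj.preconnectedSpace_closedFibre`. [cite: Hartshorne1977, III Cor. 11.3] -/
theorem geometricallyConnected_of_projective {B : Type u} [CommRing B] [IsNoetherianRing B]
    {Y : Scheme.{u}} (g : Y ⟶ Spec (.of B)) {r : ℕ} (j : Y ⟶ ProjCech.PP B r) [IsClosedImmersion j]
    (hj : j ≫ ProjCech.toSpec B r = g) [IsIso g.appTop] : GeometricallyConnected g := by
  haveI : IsProper (ProjCech.toSpec B r) := Motives.ProjBaseChangeRing.isProper_projToSpec (Fin (r + 1)) B
  haveI : IsProper g := by rw [← hj]; infer_instance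
  refine SteinFibre.geometricallyConnected_of_localConn (𝒩 := fun B _ ↦ IsNoetherianRing B)
    (𝒞 := fun B _ Y g ↦ ∃ (r : ℕ) (j : Y ⟶ ProjCech.PP B r), IsClosedImmersion j ∧
      j ≫ ProjCech.toSpec B r = g) ?_ ?_ ?_ ?_ (inferInstance : IsNoetherianRing B) g
    ⟨r, j, inferInstance, hj⟩
  · intro B _ P _ hB
    haveI : IsNoetherianRing B := hB
    infer_instance
  · intro B _ 𝔭 _ hB
    haveI : IsNoetherianRing B := hB
    infer_instance
  · rintro B B' _ _ φ Y g ⟨r, j, hjc, hjg⟩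
    haveI := hjc
    obtain ⟨j', hj'c, hj'g⟩ := ZariskiProj.exists_isClosedImmersion_pullback g φ j hjg
    exact ⟨r, j', hj'c, hj'g⟩
  · rintro B _ _ hB Y g _ ⟨r, j, hjc, hjg⟩ hiso
    haveI : IsNoetherianRing B := hB
    haveI := hjc
    haveI := hiso
    exact ZariskiProj.preconnectedSpace_closedFibre g j hjg

/-- **Stacks Project, Tag 03H2 (1) for projective morphisms over a Noetherian affine base.** For
`f : X → Spec A` proper (automatic), `A` Noetherian, admitting a closed `A`-immersion `X ↪ 𝐏^r_A`, the morphism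
`f' : X → S'` to the normalisation `S'` of `Spec A` in `X` is geometrically connected (the named fact
`steinFactorization_geometricallyConnected` for such `f`). Proof: `S' = Spec Γ(S', 𝒪)` is affine with
`Γ(S', 𝒪) ≅ Γ(X, 𝒪_X)` (Tag 03GY (3)–(4), `isIso_toNormalization_app`), finite over `A` (Serre,
`finite_algebraMapΓ_of_isClosedImmersion`) hence Noetherian, and `X` is projective over it
(`ZariskiProj.exists_isClosedImmersion_of_factor`), so `geometricallyConnected_of_projective` applies to
`X → Spec Γ(S', 𝒪)`. [cite: StacksProject, Tag 03H2 (More on Morphisms, Theorem 37.53.5 (1))] -/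
theorem steinFactorization_geometricallyConnected_projective {A : Type u} [CommRing A]
    [IsNoetherianRing A] {X : Scheme.{u}} (f : X ⟶ Spec (.of A)) [IsProper f] {r : ℕ}
    (j : X ⟶ ProjCech.PP A r) [IsClosedImmersion j] (hj : j ≫ ProjCech.toSpec A r = f) :
    GeometricallyConnected f.toNormalization := by
  -- `S'` is affine and `Γ(S') ≅ Γ(X)`
  haveI : IsAffine f.normalization := isAffine_of_isAffineHom f.fromNormalization
  have h1 : IsIso (f.toNormalization.app (f.fromNormalization ⁻¹ᵁ ⊤)) :=
    isIso_toNormalization_app f ⟨⊤, isAffineOpen_top _⟩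
  haveI h2 : IsIso f.toNormalization.appTop := h1
  have h3 : IsIso (f.normalization.isoSpec.hom).appTop := by
    show IsIso ((f.normalization.isoSpec.hom).app ⊤); infer_instance
  -- `g : X → Spec Γ(S')`
  let g : X ⟶ Spec (CommRingCat.of Γ(f.normalization, ⊤)) :=
    f.toNormalization ≫ f.normalization.isoSpec.hom
  have hgI : IsIso g.appTop := by
    show IsIso (f.toNormalization ≫ f.normalization.isoSpec.hom).appTop
    rw [Scheme.Hom.comp_appTop]; exact IsIso.comp_isIso' h3 h2
  -- `Γ(S')` is Noetherian: `Γ(X)` is finite over `A`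
  have hfin : (algebraMapΓ f).Finite := finite_algebraMapΓ_of_isClosedImmersion f j hj
  haveI : IsNoetherianRing Γ(f.normalization, ⊤) := by
    letI : Algebra A Γ(X, ⊤) := (algebraMapΓ f).toAlgebra
    haveI : Module.Finite A Γ(X, ⊤) := hfin
    have hN : IsNoetherian A Γ(X, ⊤) := isNoetherian_of_isNoetherianRing_of_finite A _
    haveI : IsNoetherianRing Γ(X, ⊤) := isNoetherian_of_tower A hN
    exact isNoetherianRing_of_ringEquiv Γ(X, ⊤) (asIso f.toNormalization.appTop).commRingCatIsoToRingEquiv.symm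
  -- `X` is projective over `Γ(S')`
  have w : j ≫ ProjCech.toSpec A r = g ≫ Spec.map (CommRingCat.ofHom (algebraMapΓ f.fromNormalization)) := by
    show _ = (f.toNormalization ≫ f.normalization.toSpecΓ) ≫ _
    rw [hj, Category.assoc, ZariskiProj.toSpecΓ_SpecMap_algebraMapΓ, Scheme.Hom.toNormalization_fromNormalization]
  obtain ⟨j', hj'c, hj'g⟩ := ZariskiProj.exists_isClosedImmersion_of_factor j g (algebraMapΓ f.fromNormalization) w
  haveI := hj'c
  have hgc : GeometricallyConnected g := @geometricallyConnected_of_projective _ _ _ _ g r j' hj'c hj'g hgI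
  have e : f.toNormalization = g ≫ f.normalization.isoSpec.inv := by
    simp only [g, Category.assoc, Iso.hom_inv_id, Category.comp_id]
  rw [e]
  exact MorphismProperty.RespectsIso.postcomp (P := @GeometricallyConnected) _ _ hgc

end Literature.AlgebraicGeometry.Morphisms

end
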